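import Literature.Probability.RandomPlanarGeometry.SAWWordBridges
import HarnessLib

/-!
# The crossing criterion for irreducible bridges is sharp

Topic `Literature/Probability/RandomPlanarGeometry` (a leaf next to `SAWWordBridges.lean`, which has
the step-word bridges `IsBridgeW`, break points `IsBreak`, `IsIrreducible`, the gap-crossing count
`crossings w h` and ONE direction of the criterion, `isIrreducible_of_crossings`: no internal column
gap crossed exactly once ⇒ no break point). Here the converse:

* `exists_xAt_step_east`, `exists_xAt_step_west` — discrete intermediate value property of the
  first coordinate (consecutive values differ by at most one, `abs_xAt_succ_sub_le`);
* `exists_isBreak_of_crossings_eq_one` — a column gap `{h, h+1}`, `1 ≤ h < span`, crossed exactly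
  once yields a break point (the unique crossing is eastward; before it the walk is in columns
  `≤ h`, after it in columns `≥ h + 1`);
* `IsBridgeW.isIrreducible_iff_crossings` — for a bridge: irreducible ⇔ no internal gap is crossed
  exactly once. This is the test by which irreducible bridges are enumerated column by column
  (Kesten's method for lower bounds on `μ`, Jensen 2004 §2.1; the strip enumerations behind the
  tilted Kraft thresholds of line `kesten-defect-renewal`, `Summits/CriticalPhenomena/SAWScalingLimit`).

## References

* H. Kesten, *On the number of self-avoiding walks*, J. Math. Phys. 4 (1963) 960–969, §4.
* I. Jensen, *Improved lower bounds on the connective constants for two-dimensional self-avoiding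
  walks*, J. Phys. A 37 (2004) 11521–11529, §2.1.
-/

open Finset Literature.Probability.LatticeModels
open scoped BigOperators

namespace Literature.Probability.RandomPlanarGeometry.SAW

/-- Discrete intermediate value property of the first coordinate, eastward: if `x(a) ≤ h` and
`h + 1 ≤ x(b)` with `a ≤ b`, some step in `[a, b)` goes from column `h` to column `h + 1`
(consecutive first coordinates differ by at most one). [folklore] -/
theorem exists_xAt_step_east (w : List Step) (h : ℤ) {a b : ℕ} (hab : a ≤ b) (ha : xAt w a ≤ h)
    (hb : h + 1 ≤ xAt w b) : ∃ i, a ≤ i ∧ i < b ∧ xAt w i = h ∧ xAt w (i + 1) = h + 1 := by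
  induction b with
  | zero =>
    obtain rfl : a = 0 := Nat.le_zero.1 hab
    omega
  | succ b ih =>
    rcases Nat.eq_or_lt_of_le hab with rfl | hlt
    · omega
    · by_cases hxb : h + 1 ≤ xAt w b
      · obtain ⟨i, h1, h2, h3, h4⟩ := ih (Nat.le_of_lt_succ hlt) hxb
        exact ⟨i, h1, Nat.lt_succ_of_lt h2, h3, h4⟩
      · have hstep := abs_xAt_succ_sub_le w b
        rw [abs_le] at hstep
        exact ⟨b, Nat.le_of_lt_succ hlt, Nat.lt_succ_self b, by omega, by omega⟩

/-- Discrete intermediate value property of the first coordinate, westward: if `h + 1 ≤ x(a)`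
and `x(b) ≤ h` with `a ≤ b`, some step in `[a, b)` goes from column `h + 1` to column `h`.
[folklore] -/
theorem exists_xAt_step_west (w : List Step) (h : ℤ) {a b : ℕ} (hab : a ≤ b) (ha : h + 1 ≤ xAt w a)
    (hb : xAt w b ≤ h) : ∃ i, a ≤ i ∧ i < b ∧ xAt w i = h + 1 ∧ xAt w (i + 1) = h := by
  induction b with
  | zero =>
    obtain rfl : a = 0 := Nat.le_zero.1 hab
    omega
  | succ b ih =>
    rcases Nat.eq_or_lt_of_le hab with rfl | hlt
    · omega
    · by_cases hxb : xAt w b ≤ h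
      · obtain ⟨i, h1, h2, h3, h4⟩ := ih (Nat.le_of_lt_succ hlt) hxb
        exact ⟨i, h1, Nat.lt_succ_of_lt h2, h3, h4⟩
      · have hstep := abs_xAt_succ_sub_le w b
        rw [abs_le] at hstep
        exact ⟨b, Nat.le_of_lt_succ hlt, Nat.lt_succ_self b, by omega, by omega⟩

/-- **A gap crossed exactly once is a break point** (converse of `crossings_eq_one_of_isBreak`;
no bridge hypothesis needed): if the column gap `{h, h+1}`, `1 ≤ h < span`, is crossed exactly
once, the unique crossing is an eastward step at a time `j` with `x(j) = h`, before which the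
walk stays in columns `≤ h` and after which it stays in columns `≥ h + 1`; so `j` is a break
point. [cite: Kesten1963SAW, §4] -/
theorem exists_isBreak_of_crossings_eq_one {w : List Step} {h : ℤ} (h1 : 1 ≤ h)
    (h2 : h < xEnd w) (hc : crossings w h = 1) : ∃ j, IsBreak w j := by
  -- the unique crossing time `j`
  obtain ⟨j, hj⟩ := List.length_eq_one_iff.1 hc
  have hmem : ∀ i, i < w.length →
      ((xAt w i = h ∧ xAt w (i + 1) = h + 1) ∨ (xAt w i = h + 1 ∧ xAt w (i + 1) = h)) → i = j := by
    intro i hi hP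
    have : i ∈ (List.range w.length).filter (fun i =>
        (xAt w i = h ∧ xAt w (i + 1) = h + 1) ∨ (xAt w i = h + 1 ∧ xAt w (i + 1) = h)) :=
      List.mem_filter.2 ⟨List.mem_range.2 hi, by simpa using hP⟩
    rw [hj] at this
    exact List.mem_singleton.1 this
  have hjmem : j ∈ (List.range w.length).filter (fun i =>
      (xAt w i = h ∧ xAt w (i + 1) = h + 1) ∨ (xAt w i = h + 1 ∧ xAt w (i + 1) = h)) := by
    rw [hj]; exact List.mem_singleton_self j
  obtain ⟨hjn, hPj⟩ := List.mem_filter.1 hjmem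
  rw [List.mem_range] at hjn
  simp only [decide_eq_true_eq] at hPj
  have hxn : h + 1 ≤ xAt w w.length := by rw [← xEnd]; omega
  -- the crossing at `j` is eastward
  have hE : xAt w j = h ∧ xAt w (j + 1) = h + 1 := by
    rcases hPj with hPj | ⟨hj1, -⟩
    · exact hPj
    · exfalso
      obtain ⟨i, -, hij, hi1, hi2⟩ := exists_xAt_step_east w h (Nat.zero_le j) (by simp; omega) (by omega)
      exact absurd (hmem i (by omega) (Or.inl ⟨hi1, hi2⟩)) (by omega)
  refine ⟨j, ?_, hjn, fun i hi => ?_, fun i hij hin => ?_⟩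
  · -- `0 < j` since `x(0) = 0 < 1 ≤ h = x(j)`
    rcases Nat.eq_zero_or_pos j with rfl | hpos
    · rw [xAt_zero] at hE; omega
    · exact hpos
  · -- before `j`: columns `≤ h`
    by_contra hlt
    rw [not_le, hE.1] at hlt
    obtain ⟨i', h1', h2', h3', h4'⟩ := exists_xAt_step_west w h hi (by omega) (le_of_eq hE.1)
    exact absurd (hmem i' (by omega) (Or.inr ⟨h3', h4'⟩)) (by omega)
  · -- after `j`: columns `> h`
    by_contra hle
    rw [not_lt, hE.1] at hle
    obtain ⟨i', h1', h2', h3', h4'⟩ := exists_xAt_step_west w h (show j + 1 ≤ i by omega)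
      (le_of_eq hE.2.symm) hle
    exact absurd (hmem i' (by omega) (Or.inr ⟨h3', h4'⟩)) (by omega)

/-- **Irreducibility criterion, both directions**: a bridge is irreducible iff none of its
internal column gaps `{h, h+1}`, `1 ≤ h < span`, is crossed exactly once
(`isIrreducible_of_crossings` and `exists_isBreak_of_crossings_eq_one`). This is the test used by strip enumerations of irreducible
bridges (Jensen 2004, §2.1). [cite: Jensen2004SAWLowerBounds, §2.1] -/
theorem IsBridgeW.isIrreducible_iff_crossings {w : List Step} (hb : IsBridgeW w) :
    IsIrreducible w ↔ ∀ h : ℤ, 1 ≤ h → h < xEnd w → crossings w h ≠ 1 := by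
  refine ⟨fun hirr h h1 h2 hc => ?_, isIrreducible_of_crossings hb⟩
  obtain ⟨j, hj⟩ := exists_isBreak_of_crossings_eq_one h1 h2 hc
  exact hirr j hj

end Literature.Probability.RandomPlanarGeometry.SAW
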